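import Literature.AnabelianGeometry.EtaleTheta.ThetaCoversAbelianWitness
import Literature.AnabelianGeometry.EtaleTheta.Discharge.Sec2Rmk211OfCoverData

/-!
# A `CoverData` whose inversion acts by `−1` on ALL of `Δ̄_X` (generalised dihedral toy): the `CoverDataAx`
# axiom `inv_theta` is INDEPENDENT of `CoverData + inv_ell + pow_mem_barKer` and NECESSARY for [EtTh] Prop 2.2 (i)

Mochizuki, *The Étale Theta Function …* [EtTh], Publ. RIMS **45** (2009), §2, Rmk 2.1.1 p. 36 (printed
p. 262), Prop 2.2 (i) p. 37 (printed p. 263): "eigenvalues `−1` and `1`, respectively"; bib key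
`MochizukiEtTh2009`. Cell abc-iut, block C (seat abc-iut-w6-d082); interface census for abc-iut-L2-t2's
`ThetaCovers.CoverData` / `CoverDataAx` (FACT-LIST rows F-0596 `Prop22_i`, F-0599 `Rmk211`).

CONTEXT (kernel, this seat's bare-interface series): (ii)/(iii) hold over the bare `CoverData` (p431949,
p432525); (i) holds from `inv_ell` + `inv_theta` at the inversion (`CoverData.prop22_i_of_inv`, p433698);
Rmk 2.1.1 from `inv_ell` alone (`CoverData.rmk211_of_inv_ell`, p433869); the central-inversion toy
(abc-iut-w6-d083, F-0596/F-0599) shows `inv_ell` is necessary for both. THIS file closes the table: a toy in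
which `inv_ell` and `pow_mem_barKer` HOLD but `inv_theta` FAILS, and Prop 2.2 (i) FAILS while Rmk 2.1.1
HOLDS — so `inv_theta` ("`+1` on `Δ̄_Θ`") is independent of the rest and necessary for (i), and Rmk 2.1.1 is
strictly weaker than (i) in axiom strength.

THE MODEL (`dihedralModel l hl : CoverData l`, every odd `l`): `Π_C := (ℤ/l)³ ⋊ C₂`, the generator of `C₂`
acting on `(ℤ/l)³` by INVERSION (`negPow3`, after abc-iut-w6-d041's `negPow`); discrete; `G_K := 1`;
`Π_X := (ℤ/l)³ ⋊ 1` (abelian, index `2`); `Ker := 1`; `Δ̄_Θ-preimage := third axis = D_x`. Then every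
`c ∈ Π_C ∖ Π_X` inverts ALL of `Π_X`, in particular `Δ̄_Θ`.

* `inv_ell_law`, `pow_l_eq_one` — the axioms `inv_ell`, `pow_mem_barKer` HOLD in the model;
* `not_inv_theta` (`1 < l`) — `inv_theta` FAILS (`c t c⁻¹ t⁻¹ = t⁻² ≠ 1`);
* `not_exists_isMinusEigen`, `not_prop22_i_model` (`1 < l`) — Prop 2.2 (i) FAILS: the field
  `IsMinusEigen.plus` ("`ι̲` acts by `+1` on `Δ̄_Θ`") is violated by every candidate `E`;
* `rmk211_model` — Rmk 2.1.1 HOLDS (by `CoverData.rmk211_of_inv_ell`);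
* `not_forall_prop22_i_of_inv_ell` — the closure "`CoverData` + `inv_ell` + `pow_mem_barKer` ⇒ Prop 2.2 (i)"
  is FALSE (instantiate `l := 3`).

CONSISTENCY/INDEPENDENCE WITNESS ONLY (a finite toy, not a curve); consistency ≠ faithfulness; no side is
taken on anything printed or on [IUTchIII] Cor. 3.12; typed ≠ proved elsewhere.
-/

namespace Literature.AnabelianGeometry.EtaleTheta.ThetaCovers.DihedralWitness

open Multiplicative AbelianWitness

variable (l : ℕ)

/-! ## 1. The group `Π_C = (ℤ/l)³ ⋊ C₂` -/

/-- `(ℤ/l)³`, written multiplicatively (plays `Δ̄_X = Δ̄^ell_X × Δ̄_Θ`, abelian here). (toy bookkeeping; no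
claim about print) [cite: MochizukiEtTh2009, Def 2.1 p.36] -/
abbrev N3 : Type := Multiplicative (ZMod l × ZMod l × ZMod l)

/-- The inversion automorphism of `(ℤ/l)³`. (toy bookkeeping) [cite: MochizukiEtTh2009, Rmk 2.1.1 p.36] -/
def negAut3 : MulAut (N3 l) := MulEquiv.inv (N3 l)

/-- `negAut3` applied: `x ↦ x⁻¹`. (toy bookkeeping) [cite: MochizukiEtTh2009, Rmk 2.1.1 p.36] -/
@[simp] theorem negAut3_apply (x : N3 l) : negAut3 l x = x⁻¹ := rfl

/-- `negAut3² = 1`. (toy bookkeeping) [cite: MochizukiEtTh2009, Rmk 2.1.1 p.36] -/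
theorem negAut3_sq : negAut3 l ^ 2 = 1 := by
  refine MulEquiv.ext fun x => ?_
  rw [pow_two, MulAut.mul_apply, negAut3_apply, negAut3_apply, inv_inv, MulAut.one_apply]

/-- The action `C₂ → Aut((ℤ/l)³)`: the generator acts by inversion. (toy bookkeeping)
[cite: MochizukiEtTh2009, Rmk 2.1.1 p.36] -/
def negPow3 : C2 →* MulAut (N3 l) where
  toFun e := negAut3 l ^ (toAdd e).val
  map_one' := by rw [toAdd_one, ZMod.val_zero, pow_zero]
  map_mul' a b := by
    rw [toAdd_mul, ZMod.val_add, ← pow_add]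
    conv_rhs => rw [← Nat.mod_add_div ((toAdd a).val + (toAdd b).val) 2, pow_add, pow_mul, negAut3_sq,
      one_pow, mul_one]

/-- The generator acts by inversion. (toy bookkeeping) [cite: MochizukiEtTh2009, Rmk 2.1.1 p.36] -/
theorem negPow3_gen_apply (x : N3 l) : negPow3 l gen x = x⁻¹ := by
  change (negAut3 l ^ (toAdd (ofAdd (1 : ZMod 2))).val) x = x⁻¹
  rw [toAdd_ofAdd, ZMod.val_one, pow_one, negAut3_apply]

/-- **`Π_C` of the toy**: `(ℤ/l)³ ⋊ C₂`, the generalised dihedral group of `(ℤ/l)³`. (toy bookkeeping)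
[cite: MochizukiEtTh2009, Def 2.1 p.36] -/
abbrev G : Type := N3 l ⋊[negPow3 l] C2

/-- **`Π_X` of the toy**: `Ker(Π_C ↠ C₂) = (ℤ/l)³ ⋊ 1` (abelian). (toy bookkeeping) [cite: MochizukiEtTh2009, Def 2.1 p.36] -/
def PiX : Subgroup (G l) := (SemidirectProduct.rightHom (N := N3 l) (G := C2) (φ := negPow3 l)).ker

/-- Membership in `Π_X`. (toy bookkeeping) [cite: MochizukiEtTh2009, Def 2.1 p.36] -/
theorem mem_PiX {x : G l} : x ∈ PiX l ↔ x.right = 1 := by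
  rw [PiX, MonoidHom.mem_ker, SemidirectProduct.rightHom_eq_right]

/-- An element of `Π_X` is `inl` of its `(ℤ/l)³`-component. (toy bookkeeping) [cite: MochizukiEtTh2009, Def 2.1 p.36] -/
theorem eq_inl_of_mem {x : G l} (hx : x ∈ PiX l) : x = SemidirectProduct.inl x.left :=
  SemidirectProduct.ext (SemidirectProduct.left_inl _).symm
    (((mem_PiX l).mp hx).trans (SemidirectProduct.right_inl _).symm)

/-- An element outside `Π_X` is `inl a · gen`. (toy bookkeeping) [cite: MochizukiEtTh2009, Def 2.1 p.36] -/
theorem eq_inl_mul_gen_of_not_mem {c : G l} (hc : c ∉ PiX l) :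
    c = SemidirectProduct.inl c.left * SemidirectProduct.inr gen := by
  have h : c.right = gen := by
    rcases eq_one_or_eq_gen c.right with h | h
    · exact absurd ((mem_PiX l).mpr h) hc
    · exact h
  rw [← h]; exact (SemidirectProduct.inl_left_mul_inr_right c).symm

/-- Conjugation of `inl d` by an element outside `Π_X` inverts it. (toy bookkeeping)
[cite: MochizukiEtTh2009, Rmk 2.1.1 p.36] -/
theorem conj_inl_of_not_mem {c : G l} (hc : c ∉ PiX l) (n : N3 l) :
    c * SemidirectProduct.inl n * c⁻¹ = SemidirectProduct.inl n⁻¹ := by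
  have h1 : (SemidirectProduct.inr gen : G l) * SemidirectProduct.inl n * (SemidirectProduct.inr gen)⁻¹ =
      SemidirectProduct.inl n⁻¹ := by
    rw [← map_inv, ← SemidirectProduct.inl_aut, negPow3_gen_apply]
  calc c * SemidirectProduct.inl n * c⁻¹
      = SemidirectProduct.inl c.left *
          (SemidirectProduct.inr gen * SemidirectProduct.inl n * (SemidirectProduct.inr gen)⁻¹) *
          (SemidirectProduct.inl c.left)⁻¹ := by
        conv_lhs => rw [eq_inl_mul_gen_of_not_mem l hc]
        group
    _ = SemidirectProduct.inl n⁻¹ := by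
        rw [h1, ← map_inv, ← map_mul, ← map_mul, mul_comm c.left n⁻¹, mul_inv_cancel_right]

/-- For `c ∉ Π_X` and `t = inl n`: `c t c⁻¹ t⁻¹ = inl (n⁻¹ n⁻¹)`. (toy bookkeeping) [cite: MochizukiEtTh2009, Rmk 2.1.1 p.36] -/
theorem conj_comm_inl_of_not_mem {c : G l} (hc : c ∉ PiX l) (n : N3 l) :
    c * SemidirectProduct.inl n * c⁻¹ * (SemidirectProduct.inl n)⁻¹ = SemidirectProduct.inl (n⁻¹ * n⁻¹) := by
  rw [conj_inl_of_not_mem l hc, map_mul, map_inv]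

/-- The third-axis embedding `c ↦ inl (0, 0, c)` (plays `Δ̄_Θ`). (toy bookkeeping) [cite: MochizukiEtTh2009, Def 2.1 p.36] -/
def thetaHom : Multiplicative (ZMod l) →* G l :=
  SemidirectProduct.inl.comp
    (((AddMonoidHom.inr (ZMod l) (ZMod l × ZMod l)).comp (AddMonoidHom.inr (ZMod l) (ZMod l))).toMultiplicative)

/-- `thetaHom c = inl (0, 0, c)`. (toy bookkeeping) [cite: MochizukiEtTh2009, Def 2.1 p.36] -/
theorem thetaHom_apply (c : Multiplicative (ZMod l)) :
    thetaHom l c = SemidirectProduct.inl (ofAdd (0, 0, toAdd c)) := rfl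

/-- `thetaHom` is injective. (toy bookkeeping) [cite: MochizukiEtTh2009, Def 2.1 p.36] -/
theorem thetaHom_injective : Function.Injective (thetaHom l) := by
  intro x y h
  have h' := congrArg (fun g : G l => (toAdd g.left).2.2) h
  simpa [thetaHom_apply] using h'

/-- **`Δ̄_Θ`-preimage of the toy** (also `D_x`): the third axis. (toy bookkeeping) [cite: MochizukiEtTh2009, Def 2.1 p.36] -/
def barTheta : Subgroup (G l) := (thetaHom l).range

/-- `Δ̄_Θ ⊆ Π_X`. (toy bookkeeping) [cite: MochizukiEtTh2009, Def 2.1 p.36] -/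
theorem barTheta_le_PiX : barTheta l ≤ PiX l := by
  rintro _ ⟨c, rfl⟩
  exact (mem_PiX l).mpr (by rw [thetaHom_apply, SemidirectProduct.right_inl])

/-- `#Δ̄_Θ-preimage = l`. (toy bookkeeping) [cite: MochizukiEtTh2009, Def 2.1 p.36] -/
theorem card_barTheta : Nat.card (barTheta l) = l := by
  rw [barTheta, ← Nat.card_congr (MonoidHom.ofInjective (thetaHom_injective l)).toEquiv,
    Nat.card_congr Multiplicative.toAdd, Nat.card_zmod]

/-- `Π_X` is abelian. (toy bookkeeping) [cite: MochizukiEtTh2009, Def 2.1 p.36] -/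
theorem PiX_comm {x y : G l} (hx : x ∈ PiX l) (hy : y ∈ PiX l) : x * y = y * x := by
  rw [eq_inl_of_mem l hx, eq_inl_of_mem l hy, ← map_mul, ← map_mul, mul_comm]

/-- `Δ̄_Θ` is normal in `Π_C` (conjugation by `Π_X` is trivial, by the other coset it inverts the axis).
(toy bookkeeping) [cite: MochizukiEtTh2009, Def 2.1 p.36] -/
theorem barTheta_normal : (barTheta l).Normal := by
  refine ⟨fun t ht g => ?_⟩
  obtain ⟨c, rfl⟩ := ht
  by_cases hg : g ∈ PiX l
  · rw [PiX_comm l hg (barTheta_le_PiX l ⟨c, rfl⟩), mul_inv_cancel_right]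
    exact ⟨c, rfl⟩
  · rw [thetaHom_apply, conj_inl_of_not_mem l hg]
    refine ⟨c⁻¹, ?_⟩
    rw [map_inv, thetaHom_apply]
    exact (map_inv (SemidirectProduct.inl : N3 l →* G l) _).symm

/-- `[Π_C : Π_X] = 2`. (toy bookkeeping) [cite: MochizukiEtTh2009, Def 2.1 p.36] -/
theorem index_PiX : (PiX l).index = 2 := by
  rw [PiX, Subgroup.index_ker, MonoidHom.range_eq_top.mpr SemidirectProduct.rightHom_surjective,
    Subgroup.card_top, Nat.card_eq_fintype_card, Fintype.card_multiplicative, ZMod.card]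

/-- The `(a, b)`-coordinates on `Π_X` (plays `Δ_X ↠ Δ̄^ell_X`). (toy bookkeeping) [cite: MochizukiEtTh2009, Def 2.1 p.36] -/
def ellCoords : ↥(PiX l ⊓ (1 : G l →* PUnit.{1}).ker) →* Multiplicative (ZMod l × ZMod l) where
  toFun x := ofAdd ((toAdd x.1.left).1, (toAdd x.1.left).2.1)
  map_one' := by simp
  map_mul' x y := by
    have hx : x.1.right = 1 := (mem_PiX l).mp x.2.1
    apply toAdd.injective
    rw [Subgroup.coe_mul, SemidirectProduct.mul_left, hx, map_one, MulAut.one_apply]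
    simp only [toAdd_mul, toAdd_ofAdd, Prod.fst_add, Prod.snd_add, Prod.mk_add_mk]

/-- The coordinates are onto `(ℤ/l)²`. (toy bookkeeping) [cite: MochizukiEtTh2009, Def 2.1 p.36] -/
theorem ellCoords_surjective : Function.Surjective (ellCoords l) := fun n =>
  ⟨⟨SemidirectProduct.inl (ofAdd ((toAdd n).1, (toAdd n).2, 0)),
    (mem_PiX l).mpr (SemidirectProduct.right_inl _), MonoidHom.mem_ker.mpr rfl⟩, by
      apply toAdd.injective; simp [ellCoords]⟩

/-- The kernel of the coordinates is `Δ̄_Θ`. (toy bookkeeping) [cite: MochizukiEtTh2009, Def 2.1 p.36] -/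
theorem ellCoords_ker : (ellCoords l).ker = (barTheta l).subgroupOf _ := by
  ext x
  rw [MonoidHom.mem_ker, Subgroup.mem_subgroupOf]
  have hx : x.1 = SemidirectProduct.inl x.1.left := eq_inl_of_mem l x.2.1
  constructor
  · intro h
    have h' := congrArg toAdd h
    simp only [ellCoords, MonoidHom.coe_mk, OneHom.coe_mk, toAdd_ofAdd, toAdd_one, Prod.mk_eq_zero] at h'
    refine ⟨ofAdd (toAdd x.1.left).2.2, ?_⟩
    rw [thetaHom_apply, hx, SemidirectProduct.left_inl, toAdd_ofAdd]
    congr 1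
    apply toAdd.injective
    rw [toAdd_ofAdd]
    ext <;> simp [h'.1, h'.2]
  · rintro ⟨c, hc⟩
    apply toAdd.injective
    have : x.1.left = ofAdd (0, 0, toAdd c) := by rw [← hc, thetaHom_apply, SemidirectProduct.left_inl]
    simp [ellCoords, this]

/-- The `a`-coordinate character on `Π_X` (the quotient `Q` of Def 2.1 in the toy). (toy bookkeeping)
[cite: MochizukiEtTh2009, Def 2.1 p.36] -/
def crdA : ↥(PiX l) →* Multiplicative (ZMod l) where
  toFun x := ofAdd (toAdd x.1.left).1
  map_one' := by simp
  map_mul' x y := by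
    have hx : x.1.right = 1 := (mem_PiX l).mp x.2
    apply toAdd.injective
    rw [Subgroup.coe_mul, SemidirectProduct.mul_left, hx, map_one, MulAut.one_apply]
    simp only [toAdd_mul, toAdd_ofAdd, Prod.fst_add]

/-- **`Π_C̲ := {x | (x.left).a = 0}`** (both cosets of `C₂`). (toy bookkeeping) [cite: MochizukiEtTh2009, Def 2.1 p.36] -/
def PiCu : Subgroup (G l) where
  carrier := {x | (toAdd x.left).1 = 0}
  mul_mem' := by
    intro x y hx hy
    simp only [Set.mem_setOf_eq, SemidirectProduct.mul_left, toAdd_mul, Prod.fst_add] at hx hy ⊢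
    rcases eq_one_or_eq_gen x.right with h | h
    · rw [h, map_one, MulAut.one_apply, hx, hy, add_zero]
    · rw [h, negPow3_gen_apply, toAdd_inv, Prod.fst_neg, hx, hy, neg_zero, add_zero]
  one_mem' := by simp
  inv_mem' := by
    intro x hx
    simp only [Set.mem_setOf_eq] at hx ⊢
    rw [SemidirectProduct.inv_left]
    rcases eq_one_or_eq_gen x.right⁻¹ with h | h
    · rw [h, map_one, MulAut.one_apply, toAdd_inv, Prod.fst_neg, hx, neg_zero]
    · rw [h, negPow3_gen_apply, inv_inv, hx]

/-- Membership in `Π_C̲`. (toy bookkeeping) [cite: MochizukiEtTh2009, Def 2.1 p.36] -/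
theorem mem_PiCu {x : G l} : x ∈ PiCu l ↔ (toAdd x.left).1 = 0 := Iff.rfl

/-! ## 2. The model -/

/-- **THE GENERALISED-DIHEDRAL MODEL**: `(ℤ/l)³ ⋊ C₂` is a `CoverData l` for every odd `l` (discrete, `G_K = 1`,
`Ker = 1`, `D_x = Δ̄_Θ-preimage = third axis`). TOY — not a claim about print. [cite: MochizukiEtTh2009, Def 2.1 p.36] -/
@[reducible] def dihedralModel (hl : Odd l) : CoverData.{0} l :=
  letI : TopologicalSpace (G l) := ⊥
  haveI : DiscreteTopology (G l) := ⟨rfl⟩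
  haveI := barTheta_normal l
  { l_odd := hl
    PiC := G l
    GK := PUnit
    aug := 1
    PiX := PiX l
    PiX_normal := MonoidHom.normal_ker _
    index_PiX := index_PiX l
    isOpen_PiX := isOpen_discrete _
    aug_PiX_surjective := fun _ => ⟨1, Subsingleton.elim _ _⟩
    barKer := ⊥
    barKer_normal := inferInstance
    isClosed_barKer := isClosed_discrete _
    barTheta := barTheta l
    barTheta_normal := barTheta_normal l
    barKer_le_barTheta := bot_le
    barTheta_le := by rw [MonoidHom.ker_one, inf_top_eq]; exact barTheta_le_PiX l
    relIndex_barKer := by rw [Subgroup.relIndex_bot_left, card_barTheta]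
    ell_rank_two := ⟨(QuotientGroup.quotientMulEquivOfEq (ellCoords_ker l).symm).trans
        (QuotientGroup.quotientKerEquivOfSurjective _ (ellCoords_surjective l))⟩
    barTheta_central := by
      intro t ht d hd
      rw [MonoidHom.ker_one, inf_top_eq] at hd
      rw [Subgroup.mem_bot, PiX_comm l (barTheta_le_PiX l ht) hd]
      group
    Dx := barTheta l
    Dx_le := barTheta_le_PiX l
    aug_Dx_surjective := fun _ => ⟨1, Subsingleton.elim _ _⟩
    inertia_sup_barKer := by rw [MonoidHom.ker_one, inf_top_eq, sup_bot_eq] }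

variable {l} (hl : Odd l)

/-- **`inv_ell` HOLDS in the model**: an element outside `Π_X` inverts every `d ∈ Π_X`, so `c d c⁻¹ d = 1 ∈ Δ̄_Θ-preimage`.
[cite: MochizukiEtTh2009, Rmk 2.1.1 p.36] -/
theorem inv_ell_law : ∀ c ∈ (dihedralModel l hl).DeltaC, c ∉ (dihedralModel l hl).PiX →
    ∀ d ∈ (dihedralModel l hl).DeltaX, c * d * c⁻¹ * d ∈ (dihedralModel l hl).barTheta := by
  intro c _ hc d hd
  change d ∈ PiX l ⊓ _ at hd
  change c ∉ PiX l at hc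
  rw [eq_inl_of_mem l hd.1, conj_inl_of_not_mem l hc, ← map_mul, inv_mul_cancel, map_one]
  exact Subgroup.one_mem _

/-- **`pow_mem_barKer` HOLDS in the model**: `Π_X ≅ (ℤ/l)³` has exponent `l`. [cite: MochizukiEtTh2009, Def 2.1 p.36] -/
theorem pow_l_eq_one : ∀ d ∈ (dihedralModel l hl).DeltaX, d ^ l ∈ (dihedralModel l hl).barKer := by
  intro d hd
  change d ∈ PiX l ⊓ _ at hd
  change d ^ l ∈ (⊥ : Subgroup (G l))
  rw [Subgroup.mem_bot, eq_inl_of_mem l hd.1, ← map_pow]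
  have : d.left ^ l = 1 := by
    apply toAdd.injective
    rw [toAdd_pow, toAdd_one]
    ext <;> simp
  rw [this, map_one]

/-- The heart of the two failures below (`1 < l`): an element outside `Π_X` does NOT centralise
`t₁ := inl (0, 0, 1) ∈ Δ̄_Θ-preimage`; indeed `c t₁ c⁻¹ t₁⁻¹ = t₁⁻² ≠ 1` as `1 + 1 ≠ 0` in `ℤ/l`, `l` odd, `l ≠ 1`.
[cite: MochizukiEtTh2009, Prop 2.2(i) p.37] -/
theorem conj_comm_thetaOne_ne_one (hl : Odd l) (h1 : 1 < l) {c : G l} (hc : c ∉ PiX l) :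
    c * thetaHom l (ofAdd 1) * c⁻¹ * (thetaHom l (ofAdd 1))⁻¹ ≠ 1 := by
  intro h2
  rw [thetaHom_apply, conj_comm_inl_of_not_mem l hc, ← (SemidirectProduct.inl (φ := negPow3 l)).map_one,
    SemidirectProduct.inl_injective.eq_iff] at h2
  have h3 := congrArg (fun n : N3 l => (toAdd n).2.2) h2
  simp only [toAdd_mul, toAdd_inv, toAdd_ofAdd, Prod.snd_add, Prod.snd_neg, toAdd_one, Prod.snd_zero] at h3
  haveI : Nontrivial (ZMod l) := ZMod.nontrivial_iff.mpr (by omega)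
  have h4 : (1 : ZMod l) + 1 = 0 := by
    have := congrArg (fun z : ZMod l => -z) h3
    simpa using this
  exact one_ne_zero ((ZMod.add_self_eq_zero_iff_eq_zero hl).mp h4)

/-- **`inv_theta` FAILS in the model** (`1 < l`): the generator `inr gen` inverts `Δ̄_Θ`.
[cite: MochizukiEtTh2009, Prop 2.2(i) p.37] -/
theorem not_inv_theta (h1 : 1 < l) : ¬ ∀ c ∈ (dihedralModel l hl).DeltaC, c ∉ (dihedralModel l hl).PiX →
    ∀ t ∈ (dihedralModel l hl).barTheta, c * t * c⁻¹ * t⁻¹ ∈ (dihedralModel l hl).barKer := by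
  intro h
  have hc : (SemidirectProduct.inr gen : G l) ∉ PiX l := by
    intro hmem
    have := (mem_PiX l).mp hmem
    rw [SemidirectProduct.right_inr] at this
    exact absurd (congrArg toAdd this) (by decide)
  have h2 := h (SemidirectProduct.inr gen) (MonoidHom.mem_ker.mpr rfl) hc _ ⟨ofAdd 1, rfl⟩
  exact conj_comm_thetaOne_ne_one hl h1 hc (Subgroup.mem_bot.mp h2)

/-- **No `(−1)`-eigenspace exists in the model** (`1 < l`), for ANY datum `(H', ι̲)`: the field `IsMinusEigen.plus`
asks the inversion to CENTRALISE `Δ̄_Θ` modulo `Ker = 1`, but it inverts it. [cite: MochizukiEtTh2009, Prop 2.2(i) p.37] -/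
theorem not_exists_isMinusEigen (h1 : 1 < l) {H H' : Subgroup (G l)} {ι : G l}
    (hι : (dihedralModel l hl).IsInversion H' ι) : ¬ ∃ E, (dihedralModel l hl).IsMinusEigen H H' ι E := by
  rintro ⟨E, hE⟩
  exact conj_comm_thetaOne_ne_one hl h1 hι.not_mem (Subgroup.mem_bot.mp (hE.plus _ ⟨ofAdd 1, rfl⟩))

/-- `Π_C̲` is of type `(1, l-tors)±` in the model. [cite: MochizukiEtTh2009, Def 2.1 p.36] -/
theorem isTypeLTorsPm_PiCu : (dihedralModel l hl).IsTypeLTorsPm (PiCu l) := by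
  refine ⟨⟨inf_le_right, ?_, ?_, ?_, ?_⟩, ?_⟩
  · refine ⟨crdA l, fun a => ⟨⟨SemidirectProduct.inl (ofAdd (toAdd a, 0, 0)),
      (mem_PiX l).mpr (SemidirectProduct.right_inl _)⟩, by apply toAdd.injective; simp [crdA]⟩, fun g => ?_⟩
    change crdA l g = 1 ↔ (g : G l) ∈ PiCu l ⊓ PiX l
    rw [Subgroup.mem_inf, mem_PiCu]
    constructor
    · intro h
      exact ⟨by simpa [crdA] using congrArg toAdd h, g.2⟩
    · intro h
      apply toAdd.injective
      simpa [crdA] using h.1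
  · rintro _ ⟨c, rfl⟩
    exact ⟨(mem_PiCu l).mpr (by rw [thetaHom_apply, SemidirectProduct.left_inl, toAdd_ofAdd]),
      barTheta_le_PiX l ⟨c, rfl⟩⟩
  · change PiCu l ⊓ PiX l ⊔ (PiX l ⊓ (1 : G l →* PUnit).ker) = PiX l
    rw [MonoidHom.ker_one, inf_top_eq]
    exact le_antisymm (sup_le inf_le_right le_rfl) le_sup_right
  · rintro _ ⟨c, rfl⟩
    exact ⟨(mem_PiCu l).mpr (by rw [thetaHom_apply, SemidirectProduct.left_inl, toAdd_ofAdd]),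
      barTheta_le_PiX l ⟨c, rfl⟩⟩
  · have hs : Function.Surjective
        ((SemidirectProduct.rightHom (φ := negPow3 l)).comp (PiCu l).subtype) :=
      fun s => ⟨⟨SemidirectProduct.inr s, (mem_PiCu l).mpr (by simp)⟩, by simp⟩
    have hker : ((SemidirectProduct.rightHom (φ := negPow3 l)).comp (PiCu l).subtype).ker =
        (PiCu l ⊓ PiX l).subgroupOf (PiCu l) := by
      ext g
      rw [MonoidHom.mem_ker, Subgroup.mem_subgroupOf, Subgroup.mem_inf, mem_PiX]
      exact ⟨fun h => ⟨g.2, h⟩, fun h => h.2⟩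
    change ((PiCu l ⊓ PiX l).subgroupOf (PiCu l)).index = 2
    rw [← hker, Subgroup.index_ker, MonoidHom.range_eq_top.mpr hs, Subgroup.card_top,
      Nat.card_eq_fintype_card, Fintype.card_multiplicative, ZMod.card]

/-- `inr gen` is an inversion for `Π_C̲` in the model. [cite: MochizukiEtTh2009, Prop 2.2 p.36] -/
theorem isInversion_gen : (dihedralModel l hl).IsInversion (PiCu l) (SemidirectProduct.inr gen) := by
  refine ⟨(mem_PiCu l).mpr (by simp), MonoidHom.mem_ker.mpr rfl, fun hmem => ?_⟩
  have := (mem_PiX l).mp hmem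
  rw [SemidirectProduct.right_inr] at this
  exact absurd (congrArg toAdd this) (by decide)

/-- **Prop 2.2 (i) FAILS in the generalised-dihedral model** (`1 < l`), although `inv_ell` and `pow_mem_barKer`
hold there: `inv_theta` is NECESSARY for (i). [cite: MochizukiEtTh2009, Prop 2.2(i) p.37] -/
theorem not_prop22_i_model (h1 : 1 < l) : ¬ (dihedralModel l hl).Prop22_i := fun h =>
  not_exists_isMinusEigen hl h1 (isInversion_gen hl)
    ((h _ _ _ (isTypeLTorsPm_PiCu hl) rfl (isInversion_gen hl)).exists)

/-- **Rmk 2.1.1 HOLDS in the generalised-dihedral model** (by `CoverData.rmk211_of_inv_ell` and `inv_ell_law`):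
Rmk 2.1.1 is strictly weaker than Prop 2.2 (i) in axiom strength. [cite: MochizukiEtTh2009, Rmk 2.1.1 p.36] -/
theorem rmk211_model : (dihedralModel l hl).Rmk211 :=
  (dihedralModel l hl).rmk211_of_inv_ell (inv_ell_law hl)

/-- **The closure "`CoverData` + `inv_ell` + `pow_mem_barKer` ⇒ Prop 2.2 (i)" is FALSE** (`l := 3`): the
`CoverDataAx` axiom `inv_theta` is independent of the other two over `CoverData` and necessary for F-0596
`CoverData.Prop22_i`. [cite: MochizukiEtTh2009, Prop 2.2(i) p.37] -/
theorem not_forall_prop22_i_of_inv_ell :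
    ¬ ∀ (l : ℕ) (X : CoverData.{0} l),
      (∀ c ∈ X.DeltaC, c ∉ X.PiX → ∀ d ∈ X.DeltaX, c * d * c⁻¹ * d ∈ X.barTheta) →
      (∀ d ∈ X.DeltaX, d ^ l ∈ X.barKer) →
      Literature.AnabelianGeometry.EtaleTheta.ThetaCovers.CoverData.Prop22_i X :=
  fun h => not_prop22_i_model (l := 3) ⟨1, rfl⟩ (by norm_num)
    (h 3 _ (inv_ell_law (l := 3) ⟨1, rfl⟩) (pow_l_eq_one (l := 3) ⟨1, rfl⟩))

end Literature.AnabelianGeometry.EtaleTheta.ThetaCovers.DihedralWitness
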